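import Mathlib
import HarnessLib
import Literature.MathematicalPhysics.QuantumFieldTheory.ConstructiveQFTWave0
import Summits.Ventures.LatticeQCDFlow.Scaling.LatticeComb

/-!
# LatticeQCDFlow / Scaling — forests of links are gauge trivial (configuration-level maximal-tree
# gauge for EVERY forest, by pruning induction)

HONEST FRAMING: exact (Metropolis-corrected) sampling algorithms for lattice gauge theory;
figures of merit are autocorrelation/cost numbers at stated couplings and volumes; no
continuum-physics claim.

Venture `LatticeQCDFlow` (cell pub-lqcd), topic `Scaling`, FANOUT row 30 (lean-1, GEN-15) — OUR WORK,
the combinatorial heart of the gauge-redundancy files (`Scaling/AutoregressiveGaugeRedundancy*`):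
maximal-tree / axial gauge fixing (M. Creutz, *Quarks, gluons and lattices* (1983) Ch. 9;
C. Gattringer, C. B. Lang, LNP 788 §3.2.2) at the level of CONFIGURATIONS and for EVERY forest of
links of the torus `(ℤ/L)^d`, any group `G` (no topology, no measure): the tree's
`Scaling/LatticeTreeGauge` proves the INTEGRATED statement for the specific comb; here

* `gaugeTransform_update_apply_of_not_incident`, `exists_update_gaugeTransform_apply_eq` — adjusting
  a gauge transformation at one site moves only the links at that site, and realises any prescribed
  value on a non-loop link there;
* **`exists_gaugeTransform_eq_on_forest`** — FORESTS ARE GAUGE TRIVIAL: for a PRUNING CERTIFICATE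
  `T = [(ℓ_1,x_1), …, (ℓ_k,x_k)]` (each `ℓ_m` a non-loop link with endpoint `x_m` touched by no LATER
  `ℓ_n`; every forest admits one by peeling leaves, and every such list is a forest) and ANY two
  configurations `U, U'` there is a gauge transformation `γ` with `(U^γ)_{ℓ_m} = U'_{ℓ_m}` for all `m`
  (induction from the back of the list);
* **`exists_gaugeTransform_forest_eq_one`** (axial gauge on any forest: `(U^γ)_{ℓ_m} = 1`) and
  **`exists_gaugeTransform_forest_eq_one_wilsonAction`** (… with `S_W(U^γ) = S_W(U)`, tree
  `wilsonAction_gaugeTransform`);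
* the RANK FORM of the certificate (a finset `T`, private endpoints `x ℓ` and a rank `r` such that no
  OTHER link of `T` of rank `≤ r ℓ` touches `x ℓ` — closed under taking subsets):
  **`exists_gaugeTransform_eq_on_rankForest`** (induction on the maximal-rank link, Mathlib
  `Finset.induction_on_max_value`), and the COMB of the tree's `Scaling/LatticeComb` (`treeEdges`,
  `head`, `rank`, `free_of_max`, `#V − 1 ≤ #comb`): **`exists_gaugeTransform_eq_on_comb_subset`** —
  every subset of the comb (hence every prefix of any generation order of its `≥ L^d − 1` links) is
  gauge trivial.

The measure-theoretic consequences (the marginal of the links of a forest is constant; exact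
autoregressive conditionals along a forest are Haar) are `Scaling/AutoregressiveGaugeForestTrivial`.
NOT CLAIMED: uniqueness of `γ`, cycles, any number of ours.  No definition is introduced; nothing is
cited as a fact; no `sorry`.
-/

noncomputable section

namespace Summit.Ventures.LatticeQCDFlow.Theory2.Autoregressive

open Function
open Literature.MathematicalPhysics.QuantumFieldTheory

variable {d L N : ℕ} {G : Type*} [Group G]

/-! ## §1 Forests are gauge trivial -/

/-- Adjusting a gauge transformation at one site `x` does not change its action on links not
touching `x`. [ours] -/
theorem gaugeTransform_update_apply_of_not_incident (γ : Site d L → G) (x : Site d L) (g : G)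
    (U : GaugeConfig d L G) {e : Edge d L} (h1 : e.1 ≠ x) (h2 : e.1.shift e.2 ≠ x) :
    gaugeTransform (update γ x g) U e = gaugeTransform γ U e := by
  simp [gaugeTransform, update_of_ne h1, update_of_ne h2]

/-- Adjusting a gauge transformation at an endpoint `x` of a non-loop link `ℓ` realises any
prescribed value on `ℓ`. [ours] -/
theorem exists_update_gaugeTransform_apply_eq (γ : Site d L → G) {x : Site d L} (U : GaugeConfig d L G)
    {ℓ : Edge d L} (hinc : ℓ.1 = x ∨ ℓ.1.shift ℓ.2 = x) (hloop : ℓ.1 ≠ ℓ.1.shift ℓ.2) (h : G) :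
    ∃ g : G, gaugeTransform (update γ x g) U ℓ = h := by
  rcases hinc with h1 | h2
  · have h2 : ℓ.1.shift ℓ.2 ≠ x := fun h2 => hloop (h1.trans h2.symm)
    refine ⟨h * γ (ℓ.1.shift ℓ.2) * (U ℓ)⁻¹, ?_⟩
    subst h1
    simp only [gaugeTransform, update_self, update_of_ne h2]
    group
  · have h1 : ℓ.1 ≠ x := fun h1 => hloop (h1.trans h2.symm)
    refine ⟨h⁻¹ * γ ℓ.1 * U ℓ, ?_⟩
    subst h2
    simp only [gaugeTransform, update_self, update_of_ne h1]
    group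

/-- **FORESTS ARE GAUGE TRIVIAL.**  For a pruning certificate `T` (a list of (link, site) pairs:
each link is not a loop, the site is one of its endpoints, and no LATER link of the list touches that
site) and any two configurations `U, U'`, some gauge transformation maps `U` to `U'` on every link of
`T`. [ours] -/
theorem exists_gaugeTransform_eq_on_forest :
    ∀ (T : List (Edge d L × Site d L)),
      (∀ p ∈ T, (p.1.1 = p.2 ∨ p.1.1.shift p.1.2 = p.2) ∧ p.1.1 ≠ p.1.1.shift p.1.2) →
      T.Pairwise (fun p q => ¬ (q.1.1 = p.2 ∨ q.1.1.shift q.1.2 = p.2)) →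
      ∀ U U' : GaugeConfig d L G, ∃ γ : Site d L → G, ∀ p ∈ T, gaugeTransform γ U p.1 = U' p.1 := by
  intro T
  induction T with
  | nil => intro _ _ U U'; exact ⟨1, fun p hp => absurd hp (by simp)⟩
  | cons p T ih =>
    intro hinc hpw U U'
    obtain ⟨hp, hpw'⟩ := List.pairwise_cons.1 hpw
    obtain ⟨γ', hγ'⟩ := ih (fun q hq => hinc q (List.mem_cons_of_mem _ hq)) hpw' U U'
    obtain ⟨hpinc, hploop⟩ := hinc p List.mem_cons_self
    obtain ⟨g, hg⟩ := exists_update_gaugeTransform_apply_eq γ' U hpinc hploop (U' p.1)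
    refine ⟨update γ' p.2 g, fun q hq => ?_⟩
    rcases List.mem_cons.1 hq with rfl | hq'
    · exact hg
    · have hni := hp q hq'
      rw [gaugeTransform_update_apply_of_not_incident γ' p.2 g U (fun h1 => hni (Or.inl h1))
        (fun h2 => hni (Or.inr h2))]
      exact hγ' q hq'

/-- **Axial gauge on any forest**: for a pruning certificate `T` and any `U` there is a gauge
transformation setting every link of `T` to `1`. [ours] -/
theorem exists_gaugeTransform_forest_eq_one (T : List (Edge d L × Site d L))
    (hinc : ∀ p ∈ T, (p.1.1 = p.2 ∨ p.1.1.shift p.1.2 = p.2) ∧ p.1.1 ≠ p.1.1.shift p.1.2)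
    (hpw : T.Pairwise (fun p q => ¬ (q.1.1 = p.2 ∨ q.1.1.shift q.1.2 = p.2)))
    (U : GaugeConfig d L G) : ∃ γ : Site d L → G, ∀ p ∈ T, gaugeTransform γ U p.1 = 1 :=
  exists_gaugeTransform_eq_on_forest T hinc hpw U 1

/-- **Axial gauge on any forest, with the Wilson action unchanged** (tree
`wilsonAction_gaugeTransform`): every configuration is gauge equivalent, with the same Wilson action,
to one that is `1` on all links of the forest. [ours] -/
theorem exists_gaugeTransform_forest_eq_one_wilsonAction [NeZero L]
    (ρ : G →* Matrix (Fin N) (Fin N) ℂ) (T : List (Edge d L × Site d L))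
    (hinc : ∀ p ∈ T, (p.1.1 = p.2 ∨ p.1.1.shift p.1.2 = p.2) ∧ p.1.1 ≠ p.1.1.shift p.1.2)
    (hpw : T.Pairwise (fun p q => ¬ (q.1.1 = p.2 ∨ q.1.1.shift q.1.2 = p.2)))
    (U : GaugeConfig d L G) :
    ∃ γ : Site d L → G, (∀ p ∈ T, gaugeTransform γ U p.1 = 1) ∧
      wilsonAction ρ (gaugeTransform γ U) = wilsonAction ρ U := by
  obtain ⟨γ, hγ⟩ := exists_gaugeTransform_forest_eq_one T hinc hpw U
  exact ⟨γ, hγ, wilsonAction_gaugeTransform ρ γ U⟩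

/-! ## §2 The rank form of the certificate; the comb -/

/-- **FORESTS ARE GAUGE TRIVIAL, rank form.**  Let every link `ℓ ∈ T` be a non-loop link with a
chosen endpoint `x ℓ`, and let `r` be a rank such that no OTHER link of `T` of rank `≤ r ℓ` touches
`x ℓ`.  Then any two configurations agree with a gauge transform on `T` (remove the maximal-rank
link, whose endpoint no other link of `T` touches; induction). [ours] -/
theorem exists_gaugeTransform_eq_on_rankForest [DecidableEq (Edge d L)] (x : Edge d L → Site d L)
    (r : Edge d L → ℕ) (T : Finset (Edge d L))
    (hinc : ∀ ℓ ∈ T, (ℓ.1 = x ℓ ∨ ℓ.1.shift ℓ.2 = x ℓ) ∧ ℓ.1 ≠ ℓ.1.shift ℓ.2)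
    (hfree : ∀ ℓ ∈ T, ∀ ℓ' ∈ T, ℓ' ≠ ℓ → r ℓ' ≤ r ℓ → ¬ (ℓ'.1 = x ℓ ∨ ℓ'.1.shift ℓ'.2 = x ℓ))
    (U U' : GaugeConfig d L G) : ∃ γ : Site d L → G, ∀ ℓ ∈ T, gaugeTransform γ U ℓ = U' ℓ := by
  induction T using Finset.induction_on_max_value r with
  | empty => exact ⟨1, fun ℓ hℓ => absurd hℓ (Finset.notMem_empty ℓ)⟩
  | insert a s has hmax ih =>
    have hinc' : ∀ ℓ ∈ s, (ℓ.1 = x ℓ ∨ ℓ.1.shift ℓ.2 = x ℓ) ∧ ℓ.1 ≠ ℓ.1.shift ℓ.2 :=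
      fun ℓ hℓ => hinc ℓ (Finset.mem_insert_of_mem hℓ)
    have hfree' : ∀ ℓ ∈ s, ∀ ℓ' ∈ s, ℓ' ≠ ℓ → r ℓ' ≤ r ℓ →
        ¬ (ℓ'.1 = x ℓ ∨ ℓ'.1.shift ℓ'.2 = x ℓ) :=
      fun ℓ hℓ ℓ' hℓ' => hfree ℓ (Finset.mem_insert_of_mem hℓ) ℓ' (Finset.mem_insert_of_mem hℓ')
    obtain ⟨γ', hγ'⟩ := ih hinc' hfree'
    obtain ⟨hainc, haloop⟩ := hinc a (Finset.mem_insert_self a s)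
    obtain ⟨g, hg⟩ := exists_update_gaugeTransform_apply_eq γ' U hainc haloop (U' a)
    refine ⟨update γ' (x a) g, fun ℓ hℓ => ?_⟩
    rcases Finset.mem_insert.1 hℓ with rfl | hℓs
    · exact hg
    · have hne : ℓ ≠ a := fun h => has (h ▸ hℓs)
      have hni := hfree a (Finset.mem_insert_self a s) ℓ (Finset.mem_insert_of_mem hℓs) hne
        (hmax ℓ hℓs)
      rw [gaugeTransform_update_apply_of_not_incident γ' (x a) g U (fun h1 => hni (Or.inl h1))
        (fun h2 => hni (Or.inr h2))]
      exact hγ' ℓ hℓs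

/-- **EVERY SUBSET OF THE COMB IS GAUGE TRIVIAL.**  The comb of the tree's `Scaling/LatticeComb`
(`treeEdges d L`: the `≥ L^d − 1` links `(x, i)` with `x_j = 0` for `j < i` that do not wrap;
private endpoint `head`, rank `rank`, `free_of_max`) satisfies the rank certificate, and so does
each of its subsets: for every `T ⊆ treeEdges d L` and any two configurations there is a gauge
transformation mapping one to the other on `T`. [ours] -/
theorem exists_gaugeTransform_eq_on_comb_subset [NeZero L] {T : Finset (Edge d L)}
    (hT : T ⊆ Lattice.treeEdges d L) (U U' : GaugeConfig d L G) :
    ∃ γ : Site d L → G, ∀ ℓ ∈ T, gaugeTransform γ U ℓ = U' ℓ := by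
  classical
  refine exists_gaugeTransform_eq_on_rankForest Lattice.head Lattice.rank T (fun ℓ hℓ => ?_)
    (fun ℓ hℓ ℓ' hℓ' hne hr => ?_) U U'
  · exact ⟨Or.inr rfl, fun h => Lattice.head_ne_fst (hT hℓ) (by rw [Lattice.head]; exact h.symm)⟩
  · obtain ⟨h1, h2⟩ := Lattice.free_of_max (hT hℓ) (hT hℓ') hne hr
    rintro (h | h)
    · exact h1 h
    · exact h2 h

/-- The comb has at least `L^d − 1` links (tree `card_site_sub_one_le_card_treeEdges`, restated
with `#(ℤ/L)^d = L^d`). [ours] -/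
theorem card_comb_ge [NeZero L] : L ^ d - 1 ≤ (Lattice.treeEdges d L).card := by
  have h := Lattice.card_site_sub_one_le_card_treeEdges (d := d) (L := L)
  simpa [Fintype.card_fin, ZMod.card] using h

end Summit.Ventures.LatticeQCDFlow.Theory2.Autoregressive

end
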